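import Summits.QuantumFields.YangMills.Theorems.AlphaInputsT3ACv3HLiftClause
import Summits.QuantumFields.YangMills.Theorems.AlphaInputsT3ACv3HLiftWindowKnit
import HarnessLib

/-!
# `AlphaInputsT3ACv3HLiftBigClause` — MAP #3 M22, BY NAME: **THE BIG-k CLAUSE `hBig` OF THE WINDOW KNIT IS A THEOREM, AND SO IS THE WINDOWED `hLift` BINDER** — ★w4 g3's
# ✓ `hLift_clause` (START of record ∘ kernel certificate ∘ regional Newton lift) discharges the displayed `hBig` of ★w2 g3's ✓ `hLift_window_of_clauses` at `B_big := 10²⁷`,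
# `ε_FL := 1∕(10³⁴·L)` (shape of record, ★★OWNER g26 ASSIGNMENTS 8 (d)); hence ★★★ `hLift_window_T3`: the WINDOWED `hLift` binder of ✓ `innerFineLiftsT3_of_regionalLiftsWindow_le`
# (p603716) with NO displayed hypothesis, ★★ `innerFineLiftsT3_T3` ((FL) `InnerFineLiftsT3 F 𝔠 γ hγ hγ1 K 𝔠.B₃` under the two record rows on `𝔠` only), and ★★ `bigClause_allL`
# (the `∀ L ∃ B_big ε_FL` packaging consumed by ★w2 g3's `historyTailL_of_thm1In8_bigClause_dataRows_allL`) — lane `pub-balaban3d` ∕ cell `ym3-torus`, seat `ym-ust-19936-w4` (g3)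

HONEST FRAMING.  Composition of landed theorems (`hLift_clause` p608197, `hLift_window_of_clauses`∕`innerFineLiftsT3_of_clauses` p606019).  The two rows `max (10²⁷+1) 257·L² ≤ B₃`
and `avgWindowFactor L ≤ 8·B₃·Z_full·ε_FL` are conditions on the record's constants (NODE O ∕ the `B₃`-floor, ★w6 g0's `Zfull_ge`), displayed where used; the stub 2′χ
`stub_laneRecordsV3Chi`, the crux `HistoryTailL` (which also needs T8 and NODE O's rows) and any gap are NOT claimed here; count-neutral helper toward R3 2′ (items 19936∕19935);
registry untouched; nothing about d = 4, the continuum, or a mass gap; YM₃ on T³ is rung R3 of the YM ladder, not the Clay problem.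

References: T. Bałaban, Commun. Math. Phys. 102 (1985) 277–309 [Balaban1985Variational] (Thm 1 (8) p.279, (11)–(15) pp.279–280); CMP 102 (1985) 255–275 [Balaban1985UV3]
((7) p.257, (40)+(42) p.266, (45) p.267); CMP 98 (1985) 17–51 [Balaban1985Averaging] (Props. 4–5 pp.38–42).
-/

set_option autoImplicit false

noncomputable section

namespace Summit.QuantumFields.YangMills.Theorems.HLiftWindowKnit

open scoped Matrix.Norms.L2Operator
open Literature.MathematicalPhysics.QuantumFieldTheory.Balaban1983to89
open Literature.MathematicalPhysics.QuantumFieldTheory.Balaban1983to89.T3ContinuumYM3Torus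
open Literature.MathematicalPhysics.QuantumFieldTheory.Balaban1983to89.T3UnitLawDensityEML (ℰp)
open Literature.MathematicalPhysics.QuantumFieldTheory.Balaban1983to89.T3UnitScaleTilt (θBal)
open Literature.MathematicalPhysics.QuantumFieldTheory.Balaban1983to89.B10Eq38TorusDomains (plaqsIn)
open Literature.MathematicalPhysics.QuantumFieldTheory.Balaban1983to89.B10Eq42TorusConstraint (bondsIn)
open Literature.MathematicalPhysics.QuantumFieldTheory.Balaban1985CMP102.Setting
open Summit.QuantumFields.Balaban3D.Carriers
open Summit.QuantumFields.Balaban3D.Proofs.Primitives (AlphaConsts)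

variable (F : T3Family) (𝔠 : AlphaConsts F.L (suGroupModel 2).N) (γ : ℝ) (hγ : 0 < γ) (hγ1 : γ ≤ (min 𝔠.gamma0 1) ^ 2) (K : ℕ)

/-- **★★ THE BIG-k CLAUSE OF RECORD DISCHARGES `hBig`** at `B_big := 10²⁷`, `ε_FL := 1∕(10³⁴·L)`: the displayed hypothesis of `hLift_window_of_clauses` ∕ `innerFineLiftsT3_of_clauses` ∕
`flConjunct_of_clauses` holds, by ★w4 g3's `hLift_clause` (`n := Fin 2`). [cite: Balaban1985Variational, Thm 1 (8) p.279, (11)–(15) pp.279–280] -/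
theorem hBig_of_hLift_clause :
    ∀ (k : ℕ), k + 1 ≤ K → 16 ≤ (F.P K).L ^ k → 4 * (F.P K).L ^ k ≤ (F.P K).sitesPerDir 0 → ∀ (h : Hist (F.P K) (k + 1)),
      Hist.Admissible 𝔠.lane.carrier.M₁ (rcolOf (T3Scales F γ hγ (hγ1.trans (sq_min_one_le _ 𝔠.gamma0_pos)) K) 𝔠.lane.carrier) (k + 1) h →
      h ≠ Hist.triv (F.P K) (k + 1) → ∀ (V : GaugeField (F.P K) k (Matrix.specialUnitaryGroup (Fin 2) ℂ)) (ε' : ℝ), 0 < ε' → ε' ≤ 1 / (10 ^ 34 * (F.L : ℝ)) →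
        (∀ Q : Plaq (F.P K) k, Q ∈ plaqsIn k (Omega 𝔠.lane.carrier.M₁
            (rcolOf (T3Scales F γ hγ (hγ1.trans (sq_min_one_le _ 𝔠.gamma0_pos)) K) 𝔠.lane.carrier) (k + 1) h (k + 1)) →
          GaugeGroup.dist1 (GaugeField.plaqHol V Q) ≤ ε') →
        ∃ U : GaugeField (F.P K) 0 (Matrix.specialUnitaryGroup (Fin 2) ℂ),
          (∀ b : PBond (F.P K) k, b ∈ bondsIn k (Omega 𝔠.lane.carrier.M₁
              (rcolOf (T3Scales F γ hγ (hγ1.trans (sq_min_one_le _ 𝔠.gamma0_pos)) K) 𝔠.lane.carrier) (k + 1) h (k + 1)) →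
            Averaging.iter (fun i => BlockAveraging.blockAvg (P := F.P K) (j := i) ℰp) k U b = V b) ∧
          ∀ q : Plaq (F.P K) 0, q ∈ plaqsIn 0 (Omega 𝔠.lane.carrier.M₁
              (rcolOf (T3Scales F γ hγ (hγ1.trans (sq_min_one_le _ 𝔠.gamma0_pos)) K) 𝔠.lane.carrier) (k + 1) h (k + 1)) →
            GaugeGroup.dist1 (GaugeField.plaqHol U q) ≤ (10 : ℝ) ^ 27 * (ε' / (((F.P K).L : ℝ) ^ k) ^ 2) := by
  intro k hk hm hN4 h _ _ V ε' hε hεFL hV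
  exact TubeStart.hLift_clause F K _ _ (Fintype.card_fin 2) (by omega) hm hN4 h V hε hεFL hV

/-- **★★ THE `∀ L ∃ (B_big, ε_FL)` PACKAGING** consumed by ★w2 g3's `historyTailL_of_thm1In8_bigClause_dataRows_allL` ∕ `pinnedPartsT3ACRecFLChi_of_thm1_bigClause_dataRows`: for every
odd `L > 1`, with `B_big := 10²⁷`, `ε_FL := 1∕(10³⁴·L) > 0`, the big-k clause holds for every family `F` with `F.L = L`, every `𝔠`, `γ`, `K`. [cite: Balaban1985Variational, Thm 1 (8) p.279, (11)–(15) pp.279–280] -/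
theorem bigClause_allL : ∀ L : ℕ, Odd L → 1 < L → ∃ (Bbig εFL : ℝ), 0 < εFL ∧
    ∀ (F : T3Family) (hF : F.L = L) (𝔠 : AlphaConsts F.L (suGroupModel 2).N) (γ : ℝ) (hγ : 0 < γ) (hγ1 : γ ≤ (min 𝔠.gamma0 1) ^ 2) (K : ℕ),
    ∀ (k : ℕ), k + 1 ≤ K → 16 ≤ (F.P K).L ^ k → 4 * (F.P K).L ^ k ≤ (F.P K).sitesPerDir 0 → ∀ (h : Hist (F.P K) (k + 1)),
    Hist.Admissible 𝔠.lane.carrier.M₁ (rcolOf (T3Scales F γ hγ (hγ1.trans (sq_min_one_le _ 𝔠.gamma0_pos)) K) 𝔠.lane.carrier) (k + 1) h →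
    h ≠ Hist.triv (F.P K) (k + 1) → ∀ (V : GaugeField (F.P K) k (Matrix.specialUnitaryGroup (Fin 2) ℂ)) (ε' : ℝ), 0 < ε' → ε' ≤ εFL →
      (∀ Q : Plaq (F.P K) k, Q ∈ plaqsIn k (Omega 𝔠.lane.carrier.M₁
          (rcolOf (T3Scales F γ hγ (hγ1.trans (sq_min_one_le _ 𝔠.gamma0_pos)) K) 𝔠.lane.carrier) (k + 1) h (k + 1)) →
        GaugeGroup.dist1 (GaugeField.plaqHol V Q) ≤ ε') →
      ∃ U : GaugeField (F.P K) 0 (Matrix.specialUnitaryGroup (Fin 2) ℂ),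
        (∀ b : PBond (F.P K) k, b ∈ bondsIn k (Omega 𝔠.lane.carrier.M₁
            (rcolOf (T3Scales F γ hγ (hγ1.trans (sq_min_one_le _ 𝔠.gamma0_pos)) K) 𝔠.lane.carrier) (k + 1) h (k + 1)) →
          Averaging.iter (fun i => BlockAveraging.blockAvg (P := F.P K) (j := i) ℰp) k U b = V b) ∧
        ∀ q : Plaq (F.P K) 0, q ∈ plaqsIn 0 (Omega 𝔠.lane.carrier.M₁
            (rcolOf (T3Scales F γ hγ (hγ1.trans (sq_min_one_le _ 𝔠.gamma0_pos)) K) 𝔠.lane.carrier) (k + 1) h (k + 1)) →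
          GaugeGroup.dist1 (GaugeField.plaqHol U q) ≤ Bbig * (ε' / (((F.P K).L : ℝ) ^ k) ^ 2) := by
  intro L _ hL
  have hLpos : (0 : ℝ) < (L : ℝ) := by exact_mod_cast (zero_lt_one.trans hL)
  refine ⟨(10 : ℝ) ^ 27, 1 / (10 ^ 34 * (L : ℝ)), by positivity, fun F hF 𝔠 γ hγ hγ1 K => ?_⟩
  subst hF
  exact hBig_of_hLift_clause F 𝔠 γ hγ hγ1 K

/-- **★★★ THE WINDOWED `hLift` BINDER IS A THEOREM** (no displayed hypothesis): for every `k + 1 ≤ K`, every admissible non-trivial level-`(k+1)` history `h`, every level-`k` datum `V`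
windowed by `ε_W(k) = 2L²·avgWindowFactor L·θ(K−k)` on `plaqsIn k Ω_{k+1}(h)`, and `ε_W(k) ≤ 1∕(10³⁴·L)`: an exact `k`-fold `ℰp`-lift `U` of `V` on `bondsIn k Ω_{k+1}(h)` with constrained finest
plaquettes `< max (10²⁷+1) 257·ε_W(k)·(Lᵏ)⁻²` — ★w2 g3's `hLift_window_of_clauses` (small `k`: LEAD's `hLift_small`) with `hBig` discharged by `hBig_of_hLift_clause`.
[cite: Balaban1985Variational, Thm 1 (8) p.279, (11)–(15) pp.279–280; Balaban1985UV3, (40)+(42) p.266] -/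
theorem hLift_window_T3 :
    ∀ (k : ℕ), k + 1 ≤ K → ∀ (h : Hist (F.P K) (k + 1)),
      Hist.Admissible 𝔠.lane.carrier.M₁ (rcolOf (T3Scales F γ hγ (hγ1.trans (sq_min_one_le _ 𝔠.gamma0_pos)) K) 𝔠.lane.carrier) (k + 1) h →
      h ≠ Hist.triv (F.P K) (k + 1) → ∀ (V : GaugeField (F.P K) k (Matrix.specialUnitaryGroup (Fin 2) ℂ)),
        (∀ Q : Plaq (F.P K) k, Q ∈ plaqsIn k (Omega 𝔠.lane.carrier.M₁
            (rcolOf (T3Scales F γ hγ (hγ1.trans (sq_min_one_le _ 𝔠.gamma0_pos)) K) 𝔠.lane.carrier) (k + 1) h (k + 1)) →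
          GaugeGroup.dist1 (GaugeField.plaqHol V Q) ≤ 2 * (F.L : ℝ) ^ 2 * avgWindowFactor F.L * θBal F.L γ 𝔠.b₀ 𝔠.p₀ (K - k)) →
        2 * (F.L : ℝ) ^ 2 * avgWindowFactor F.L * θBal F.L γ 𝔠.b₀ 𝔠.p₀ (K - k) ≤ 1 / (10 ^ 34 * (F.L : ℝ)) →
        ∃ U : GaugeField (F.P K) 0 (Matrix.specialUnitaryGroup (Fin 2) ℂ),
          (∀ b : PBond (F.P K) k, b ∈ bondsIn k (Omega 𝔠.lane.carrier.M₁
              (rcolOf (T3Scales F γ hγ (hγ1.trans (sq_min_one_le _ 𝔠.gamma0_pos)) K) 𝔠.lane.carrier) (k + 1) h (k + 1)) →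
            Averaging.iter (fun i => BlockAveraging.blockAvg (P := F.P K) (j := i) ℰp) k U b = V b) ∧
          ∀ q : Plaq (F.P K) 0, q ∈ plaqsIn 0 (Omega 𝔠.lane.carrier.M₁
              (rcolOf (T3Scales F γ hγ (hγ1.trans (sq_min_one_le _ 𝔠.gamma0_pos)) K) 𝔠.lane.carrier) (k + 1) h (k + 1)) →
            GaugeGroup.dist1 (GaugeField.plaqHol U q) <
              max ((10 : ℝ) ^ 27 + 1) 257 * (2 * (F.L : ℝ) ^ 2 * avgWindowFactor F.L * θBal F.L γ 𝔠.b₀ 𝔠.p₀ (K - k)) * (((F.L : ℝ) ^ k)⁻¹) ^ 2 :=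
  hLift_window_of_clauses F 𝔠 γ hγ hγ1 K (hBig_of_hLift_clause F 𝔠 γ hγ hγ1 K)

/-- **★★ (FL) AT THE RECORD'S `B₃` UNDER THE TWO RECORD ROWS ONLY**: `max (10²⁷+1) 257·L² ≤ B₃` and `avgWindowFactor L ≤ 8·B₃·Z_full·(1∕(10³⁴·L))` give
`InnerFineLiftsT3 F 𝔠 γ hγ hγ1 K 𝔠.B₃` — ★w2 g3's `innerFineLiftsT3_of_clauses` with `hBig` discharged. [cite: Balaban1985Variational, Thm 1 (8) p.279, (11)–(14) pp.279–280; Balaban1985UV3, (45)+(47) p.267] -/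
theorem innerFineLiftsT3_T3 (hBB : max ((10 : ℝ) ^ 27 + 1) 257 * (F.L : ℝ) ^ 2 ≤ 𝔠.B₃)
    (hrow : avgWindowFactor F.L ≤ 8 * 𝔠.B₃ * 𝔠.Zfull * (1 / (10 ^ 34 * (F.L : ℝ)))) :
    AlphaInputsT3AC.InnerFineLiftsT3 F 𝔠 γ hγ hγ1 K 𝔠.B₃ :=
  innerFineLiftsT3_of_clauses F 𝔠 γ hγ hγ1 K hBB hrow (hBig_of_hLift_clause F 𝔠 γ hγ hγ1 K)

end Summit.QuantumFields.YangMills.Theorems.HLiftWindowKnit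

end
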